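import Summits.BirchSwinnertonDyer.BirchSwinnertonDyer.Theorems.SignedLowerHalvesSmallImageLowerHalfBothSignsRttJunctionLocalFrame
import Summits.BirchSwinnertonDyer.BirchSwinnertonDyer.Theorems.SignedLowerHalvesSmallImageLowerHalfBothSignsRttD2AuxIdealWitnessRam
import HarnessLib

/-!
# Route `SignedLowerHalves`, crux L `SmallImageLowerHalfBothSigns` (stmt-BirchSwinnertonDyer-23599), line `rtt_w3` **v23** — row S1 = J2⁺, THE LOCAL PACKAGE, STRUCTURAL FORM:
# `E = p^d · ∏_{w ∈ T} ((1+T)^{x_w} − C(θ′(φ_w)·χ_cyc(φ_w)))` THROWS honda's `𝐇¹` INTO `B′` — THE v23 STUB `stub_junctionLocal_ns` WITH ITS LINE-FILE DEFINITIONS UNFOLDED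

INPUTS hand `bsd-inputs-honda-p1` g26 under LEAD `cruxlead-stmt-BirchSwinnertonDyer-23599` g12/g13 (cell `bsd-ssimc`). Helper `--supports stmt-BirchSwinnertonDyer-23599`. THEOREMS ONLY.
v23 (LEAD g13, 04:07Z) re-typed S1 to the structural shape `∃ T φ x d, (∀ w, w ∈ T ↔ w ∈ S₀K ∧ w ∉ supp(p𝔣)) ∧ (IsArithFrobAt) ∧ (exponent clause on γK⁻¹) ∧ ∀ b,
JunctionDepletion S θ′ T φ x d • b ∈ JunctionCarrier hp hK2 S S₀ 𝔣 I` with the constant **`p^d`**. This file upgrades the constant `m²` of `…RttJunctionLocalFrame` to `p^d`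
(`m = p^a·m′`, `p ∤ m′` ⇒ `m′` is a unit of `𝒪` (tree `isUnit_natCast_padicCoeffIntegers_of_not_dvd`) ⇒ `m² ∣ p^{2a}`) and states ★★★ `exists_junctionDepletion_smul_mem_strictCarrier_ns`: EXACTLY the v23 conclusion with `JunctionDepletion`
and `JunctionCarrier` unfolded (a Theorems file cannot import the line file), from the frame clauses `hγK`, `hS₀p`, `hθfin`, `hker`, `(CharRoadFrameSupp).1`; the LEAD's `_of` glue
closes the stub by `intro …; exact` this theorem. HONEST FRAMING: row S1c (Euler identity, print «strong multiplicity one»), S2–S4′, E2, crux L, crux M and BSD remain OPEN; BSD is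
proved for NO curve. References: [PerrinRiou1994Invent] §1.3; [Rubin2000] Thm. 1.7.3, App. B.2–B.3; [NeukirchSchmidtWingberg2008] (8.6.2)–(8.6.3); [Washington1997] Prop. 13.2.
-/

set_option autoImplicit false
set_option linter.dupNamespace false -- D-0017: single-problem summit, the namespace repeats the problem name by design
noncomputable section

open scoped Classical
open NumberField IsDedekindDomain Field PowerSeries Rat.HeightOneSpectrum

namespace Summit.BirchSwinnertonDyer.BirchSwinnertonDyer.Theorems.SmallImageRttJunctionLocal

open Literature.NumberTheory.EllipticCurves Literature.NumberTheory.GaloisRepresentations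
  Literature.NumberTheory.ComplexMultiplication.EllipticUnits Literature.NumberTheory.ComplexMultiplication.EllipticUnits.JohnsonLeungKings2011
  Summit.BirchSwinnertonDyer.BirchSwinnertonDyer.Theorems.SmallImageRttD2J1 Summit.BirchSwinnertonDyer.BirchSwinnertonDyer.Theorems.SmallImageRttD2Seq
  IsDedekindDomain.HeightOneSpectrum

section PrimePower

variable {K : Type} [Field K] [NumberField K] {p : ℕ} [Fact p.Prime] (S : Set (PadicAlgCl p)) (κ : ZpExtension K p) {γ : absoluteGaloisGroup K}
  (θ' : absoluteGaloisGroup K →ₜ* (padicCoeffIntegers S)ˣ) (P : Set (HeightOneSpectrum (𝓞 K)))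

omit [NumberField K] in
/-- **`m² ∣ p^d` in `𝒪` for some `d`** (`m ≠ 0`: write `m = p^a · m′` with `p ∤ m′`, a unit of `𝒪`; `d = 2a`). [cite: Lang1990, Ch. 2 §1] -/
theorem exists_natCast_sq_dvd_prime_pow {m : ℕ} (hm : m ≠ 0) : ∃ d : ℕ, ((m : ℕ) : padicCoeffIntegers S) ^ 2 ∣ ((p : ℕ) : padicCoeffIntegers S) ^ d := by
  obtain ⟨a, m', hm', rfl⟩ := Nat.exists_eq_pow_mul_and_not_dvd hm p (Fact.out : p.Prime).ne_one
  obtain ⟨u, hu⟩ := SmallImageRttD2AuxIdeal.isUnit_natCast_padicCoeffIntegers_of_not_dvd S hm'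
  refine ⟨2 * a, Dvd.intro (((u⁻¹ * u⁻¹ : (padicCoeffIntegers S)ˣ) : padicCoeffIntegers S)) ?_⟩
  rw [Nat.cast_mul, Nat.cast_pow, ← hu, mul_pow, ← pow_mul, mul_comm a 2, mul_assoc, sq, Units.val_mul, mul_assoc, ← mul_assoc (u : padicCoeffIntegers S) (↑u⁻¹ : _),
    Units.mul_inv, one_mul, Units.mul_inv, mul_one]

/-- ★★★ **THE JUNCTION DEPLETION WITH ANY CONSTANT DIVISIBLE BY `m²`** maps `𝐇¹` into the strict carrier at `S₀ ⊆ T ∪ R` (as `junctionDepletion_smul_mem_strictCarrier`, the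
ramified places being killed by `m²`, hence by every multiple of it). [cite: PerrinRiou1994Invent, §1.3] [cite: Rubin2000, Thm. 1.7.3, App. B.2–B.3] -/
theorem junctionDepletion_smul_mem_strictCarrier_of_dvd (T : Finset (HeightOneSpectrum (𝓞 K))) (hT : ∀ w ∈ T, w ∉ P)
    (hNP : ∀ n, ramificationSubgroup K P ≤ κ.layerSubgroup n)
    (φ : HeightOneSpectrum (𝓞 K) → absoluteGaloisGroup K) (hφ : ∀ w ∈ T, IsArithFrobAt (𝓞 K) (φ w) (adicCompletionPrime K w))
    (x : HeightOneSpectrum (𝓞 K) → ℤ_[p]) (hx : ∀ w ∈ T, ∀ n, γ ^ (PadicInt.toZModPow n (x w)).val * (φ w)⁻¹ ∈ κ.layerSubgroup n)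
    (R : Set (HeightOneSpectrum (𝓞 K))) (hRp : ∀ w ∈ R, ((p : ℕ) : 𝓞 K) ∉ w.asIdeal)
    (hRR : ∀ w ∈ R, ∃ 𝔓 ∈ w.primesAbove, ∃ τ ∈ 𝔓.inertia (absoluteGaloisGroup K), θ' τ ≠ 1)
    {m : ℕ} (hRm : ∀ w ∈ R, ∀ 𝔓 ∈ w.primesAbove, ∀ τ ∈ 𝔓.inertia (absoluteGaloisGroup K), θ' τ ^ m = 1)
    {c : padicCoeffIntegers S} (hc : ((m : ℕ) : padicCoeffIntegers S) ^ 2 ∣ c)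
    (I : CycIwasawaCohomologyDataO S κ γ θ' P 1) (S₀ : Set (HeightOneSpectrum (𝓞 K))) (hS₀ : S₀ ⊆ ↑T ∪ R)
    (hStr : ∀ (n k : ℕ) (f : IwasawaAlgebraO S) (y : cycLayerCohO S κ θ' P n k 1), y ∈ strictLevel S κ θ' P S₀ n k →
      (letI := cycLayerModuleO S κ γ θ' P (show 1 ≤ 2 by norm_num) n k; f • y) ∈ strictLevel S κ θ' P S₀ n k)
    (b : I.H) :
    (PowerSeries.C c * ∏ w ∈ T, (iwasawaToIwasawaO S (binomialSeries ℤ_[p] (x w)) -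
        PowerSeries.C (((θ' (φ w) : (padicCoeffIntegers S)ˣ) : padicCoeffIntegers S) *
          padicIntToCoeffIntegers S ((GaloisRep.cyclotomicCharacter K p (φ w) : ℤ_[p]ˣ) : ℤ_[p])))) • b ∈
      strictCarrier I (strictLevel S κ θ' P S₀) hStr := by
  refine (mem_strictCarrier_strictLevel_iff S I S₀ _).mpr fun n k w hw δ ↦ ?_
  rcases hS₀ hw with hwT | hwR
  · rw [← Finset.mul_prod_erase T _ (Finset.mem_coe.mp hwT), mul_left_comm, mul_smul]
    exact locNK_cycLayerConjO_proj_frobDepletion_smul S κ θ' P (hT w (Finset.mem_coe.mp hwT)) hNP (hφ w (Finset.mem_coe.mp hwT)) I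
      (hx w (Finset.mem_coe.mp hwT)) _ n k δ
  · rw [mul_smul, I.proj_C_smul, cycLayerConjO_cycLayerScalarO]
    exact locNK_cycLayerScalarO_eq_zero_of_dvd S κ θ' P w n k hc _
      (locNK_cycLayerScalarO_natCast_sq_eq_zero_of_ramified S κ θ' P w (hRp w hwR) (hRR w hwR) (hRm w hwR) n k _)

end PrimePower

section Ns

variable {K : Type} [Field K] [NumberField K] {p : ℕ} [Fact p.Prime]

/-- ★★★ **ROW S1 OF v23 (`stub_junctionLocal_ns`), LINE-FILE DEFINITIONS UNFOLDED.** For a `ℤ_p`-extension `κ` of `K` with normalised topological generator `γ` (`hγK`), a finite set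
`S₀ ∌ (p)` of rational places (`hS₀p`) with places `S₀K` above it, a level `𝔣`, characters `χ₀, θ′` with `χ₀` of finite exponent (`hθfin`) and `θ′ = χ₀` on `Gal(K̄/K̃_∞)` (`hker`),
and the ramification clause (R) of `CharRoadFrameSupp`: THERE ARE `T` (= `S₀K ∖ supp(p𝔣)`), arithmetic Frobenius elements `φ_w`, exponents `x_w` (`γ⁻¹^{x_w mod pⁿ} φ_w⁻¹ ∈ U_n`) and
`d : ℕ` such that `(C(p^d) · ∏_{w∈T} ((1+T)^{x_w} − C(θ′(φ_w)·χ_cyc(φ_w)))) • b` (= `JunctionDepletion S θ′ T φ x d • b`) lies in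
`strictCarrier I (strictLevel S κ θ′ (supp p𝔣) S₀K) _` (= `JunctionCarrier … I`) for EVERY `b` of EVERY cyclotomic model `I`. (L1): `[φ_w] − u_w` kills the unramified
localisations (p807937); (L2): `(ζ₀−1)²`, hence `p^d`, kills the `θ′`-ramified ones (p808795). [cite: PerrinRiou1994Invent, §1.3] [cite: Rubin2000, Thm. 1.7.3, App. B.2–B.3] -/
theorem exists_junctionDepletion_smul_mem_strictCarrier_ns (S : Set (PadicAlgCl p)) (κ : ZpExtension K p) {γ : absoluteGaloisGroup K} (hγ : κ.IsTopGenerator γ)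
    (S₀ : Finset (HeightOneSpectrum (𝓞 ℚ))) (hS₀p : ∀ v ∈ S₀, ((p : ℕ) : 𝓞 ℚ) ∉ v.asIdeal) (𝔣 : Ideal (𝓞 K)) (κ₂ : ZpExtension K p)
    {χ₀ : absoluteGaloisGroup K →ₜ* (padicCoeffIntegers S)ˣ} (θ' : absoluteGaloisGroup K →ₜ* (padicCoeffIntegers S)ˣ)
    (hθfin : ∃ m : ℕ, 0 < m ∧ ∀ τ : absoluteGaloisGroup K, χ₀ τ ^ m = 1) (hker : ∀ τ ∈ ZpExtension.pairKer κ κ₂, θ' τ = χ₀ τ)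
    (hR : ∀ w ∈ suppPF p 𝔣, ((p : ℕ) : 𝓞 K) ∉ w.asIdeal → ∃ 𝔓 ∈ w.primesAbove, ∃ τ ∈ 𝔓.inertia (absoluteGaloisGroup K), θ' τ ≠ 1)
    (I : CycIwasawaCohomologyDataO S κ γ⁻¹ θ' (suppPF p 𝔣) 1) :
    ∃ (T : Finset (HeightOneSpectrum (𝓞 K))) (φ : HeightOneSpectrum (𝓞 K) → absoluteGaloisGroup K) (x : HeightOneSpectrum (𝓞 K) → ℤ_[p]) (d : ℕ),
      (∀ w, w ∈ T ↔ (w ∈ {w : HeightOneSpectrum (𝓞 K) | ∃ v ∈ S₀, ((natGenerator v : ℕ) : 𝓞 K) ∈ w.asIdeal} ∧ w ∉ suppPF p 𝔣)) ∧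
      (∀ w ∈ T, IsArithFrobAt (𝓞 K) (φ w) (adicCompletionPrime K w)) ∧
      (∀ w ∈ T, ∀ n : ℕ, γ⁻¹ ^ (PadicInt.toZModPow n (x w)).val * (φ w)⁻¹ ∈ κ.layerSubgroup n) ∧
      ∀ b : I.H, (PowerSeries.C (((p : ℕ) : padicCoeffIntegers S) ^ d) *
          ∏ w ∈ T, (iwasawaToIwasawaO S (PowerSeries.binomialSeries ℤ_[p] (x w)) -
            PowerSeries.C (((θ' (φ w) : (padicCoeffIntegers S)ˣ) : padicCoeffIntegers S) *
              padicIntToCoeffIntegers S ((GaloisRep.cyclotomicCharacter K p (φ w) : ℤ_[p]ˣ) : ℤ_[p])))) • b ∈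
        strictCarrier I (strictLevel S κ θ' (suppPF p 𝔣) {w : HeightOneSpectrum (𝓞 K) | ∃ v ∈ S₀, ((natGenerator v : ℕ) : 𝓞 K) ∈ w.asIdeal})
          (fun n k f _ hy ↦ smul_mem_strictLevel S κ θ' (suppPF p 𝔣) {w : HeightOneSpectrum (𝓞 K) | ∃ v ∈ S₀, ((natGenerator v : ℕ) : 𝓞 K) ∈ w.asIdeal} γ⁻¹ n k f hy) := by
  obtain ⟨m, hm0, hχ₀m⟩ := hθfin
  obtain ⟨d, hd⟩ := exists_natCast_sq_dvd_prime_pow S hm0.ne'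
  have hfin : ({w : HeightOneSpectrum (𝓞 K) | ∃ v ∈ S₀, ((natGenerator v : ℕ) : 𝓞 K) ∈ w.asIdeal} \ suppPF p 𝔣).Finite :=
    (finite_placesAboveFinset S₀).subset Set.sdiff_subset
  -- Frobenius elements at the primes `𝔓₀(w)` and their exponents on `γ⁻¹` (`κ γ⁻¹ = −1`)
  have hF : ∀ w : HeightOneSpectrum (𝓞 K), ∃ φ : absoluteGaloisGroup K, IsArithFrobAt (𝓞 K) φ (adicCompletionPrime K w) := fun w ↦
    IsDedekindDomain.HeightOneSpectrum.exists_isArithFrobAt_of_mem_primesAbove_holds (adicCompletionPrime_mem_primesAbove K w)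
  choose φ hφ using hF
  have hx : ∀ w (n : ℕ), γ⁻¹ ^ (PadicInt.toZModPow n ((((-1 : ℤ_[p]ˣ)⁻¹ : ℤ_[p]ˣ) : ℤ_[p]) * (κ (φ w)).toAdd)).val * (φ w)⁻¹ ∈ κ.layerSubgroup n := fun w n ↦
    pow_toZModPow_val_mul_inv_mem_layerSubgroup (toAdd_apply_inv_of_isTopGenerator hγ) (φ w) n
  refine ⟨hfin.toFinset, φ, fun w ↦ (((-1 : ℤ_[p]ˣ)⁻¹ : ℤ_[p]ˣ) : ℤ_[p]) * (κ (φ w)).toAdd, d, fun w ↦ ?_, fun w _ ↦ hφ w, fun w _ n ↦ hx w n, fun b ↦ ?_⟩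
  · rw [hfin.mem_toFinset]
    rfl
  · have hsub : {w : HeightOneSpectrum (𝓞 K) | ∃ v ∈ S₀, ((natGenerator v : ℕ) : 𝓞 K) ∈ w.asIdeal} ⊆
        ↑hfin.toFinset ∪ ({w : HeightOneSpectrum (𝓞 K) | ∃ v ∈ S₀, ((natGenerator v : ℕ) : 𝓞 K) ∈ w.asIdeal} ∩ suppPF p 𝔣) := fun w hw ↦ by
      by_cases hwP : w ∈ suppPF p 𝔣
      · exact Or.inr ⟨hw, hwP⟩
      · exact Or.inl (hfin.mem_toFinset.mpr ⟨hw, hwP⟩)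
    exact junctionDepletion_smul_mem_strictCarrier_of_dvd S κ θ' (suppPF p 𝔣) hfin.toFinset (fun w hw ↦ ((hfin.mem_toFinset).mp hw).2)
      (ramificationSubgroup_suppPF_le_layerSubgroup κ 𝔣) φ (fun w _ ↦ hφ w) _ (fun w _ n ↦ hx w n)
      ({w : HeightOneSpectrum (𝓞 K) | ∃ v ∈ S₀, ((natGenerator v : ℕ) : 𝓞 K) ∈ w.asIdeal} ∩ suppPF p 𝔣)
      (fun w hw ↦ natCast_not_mem_of_mem_placesAbove hS₀p hw.1) (fun w hw ↦ hR w hw.2 (natCast_not_mem_of_mem_placesAbove hS₀p hw.1))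
      (fun w hw ↦ apply_pow_eq_one_of_mem_inertia κ κ₂ hχ₀m hker (natCast_not_mem_of_mem_placesAbove hS₀p hw.1)) hd I _ hsub _ b

end Ns

end Summit.BirchSwinnertonDyer.BirchSwinnertonDyer.Theorems.SmallImageRttJunctionLocal

end
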